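import Literature.Analysis.FluidPDE.GaussianVortexPlanar
import Literature.Analysis.Calculus.UnitIntervalParametricDeriv
import Mathlib.Analysis.Distribution.TemperateGrowth
import Mathlib.Data.Nat.Choose.Sum
import HarnessLib

/-!
# `1/φ` has temperate growth, `φ(s) = (1 − e^{−s})/s`

For the Burgers/Lamb–Oseen profile function `φ = burgersPhi`, `φ(s) = (1 − e^{−s})/s`
(`Literature.Analysis.FluidPDE.burgersPhi`, Gallay–Wayne 2006, (1.5): `v^G = (8π)⁻¹φ(|ξ|²/4)ξ^⊥`),
the reciprocal `u = 1/φ`, `u(s) = s/(1 − e^{−s})`, is a smooth function all of whose derivatives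
grow at most polynomially: `u` has temperate growth (`hasTemperateGrowth_inv_burgersPhi`). This is
the multiplier estimate that makes `x ↦ x₀x₁ u(|x|²/4) E(|x|²) e^{−|x|²/4}` a Schwartz function
for temperate `E` (the vorticity `w_∞` of Gallay–Wayne 2006, Prop. 3.1, whose radial factor is
`h = g/(2φ)`, (3.5)).

* `burgersPhi_eq_integral`: `φ(s) = ∫₀¹ e^{−sv} dv`, whence
  `iteratedDeriv n φ s = ∫₀¹ vⁿ (−1)ⁿ e^{−sv} dv` and `|φ⁽ⁿ⁾(s)| ≤ 1` for `s ≥ 0`;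
* `one_le_one_add_mul_burgersPhi`: `1/φ(s) ≤ 1 + s` (`s ≥ 0`);
* `exists_abs_iteratedDeriv_inv_burgersPhi_le`: `|u⁽ʲ⁾(s)| ≤ K (1 + s)^{j+1}` on `[0, ∞)`, by the
  Leibniz recursion `φ u⁽ⁿ⁾ = −∑_{i≥1} C(n,i) φ⁽ⁱ⁾ u⁽ⁿ⁻ⁱ⁾` (from `φu = 1`);
* `burgersPhi_neg`, `inv_burgersPhi_eq_add`: `φ(−s) = eˢ φ(s)`, `u(s) = s + u(−s)`, transferring
  the bounds to `s ≤ 0`;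
* `hasTemperateGrowth_inv_burgersPhi`.

Everything is proved; no definitions, no named facts. [folklore]
-/

noncomputable section

open Set Filter MeasureTheory intervalIntegral Finset
open scoped Topology ContDiff

namespace Literature.Analysis.FluidPDE

/-! ### `φ` as an average of exponentials; bounds on its derivatives -/

/-- `φ(s) = ∫₀¹ e^{−sv} dv`. [folklore] -/
theorem burgersPhi_eq_integral (s : ℝ) : burgersPhi s = ∫ v in (0 : ℝ)..1, Real.exp (-(s * v)) := by
  by_cases hs : s = 0
  · subst hs; simp
  · have h1 : s * ∫ v in (0 : ℝ)..1, Real.exp (-(s * v)) = ∫ u in (0 : ℝ)..s, Real.exp (-u) := by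
      have := mul_integral_comp_mul_left (a := 0) (b := 1) (c := s) (f := fun u => Real.exp (-u))
      simpa using this
    have h2 : ∫ u in (0 : ℝ)..s, Real.exp (-u) = 1 - Real.exp (-s) := by
      rw [intervalIntegral.integral_comp_neg (f := Real.exp), integral_exp, neg_zero, Real.exp_zero]
    apply mul_left_cancel₀ hs
    rw [mul_burgersPhi, h1, h2]

/-- `y ↦ e^{−y}` is smooth. [folklore] -/
theorem contDiff_exp_neg' {n : WithTop ℕ∞} : ContDiff ℝ n fun y : ℝ => Real.exp (-y) :=
  Real.contDiff_exp.comp contDiff_neg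

/-- `(d/dy)ⁿ e^{−y} = (−1)ⁿ e^{−y}`. [folklore] -/
theorem iteratedDeriv_exp_neg' (n : ℕ) (y : ℝ) :
    iteratedDeriv n (fun y : ℝ => Real.exp (-y)) y = (-1) ^ n * Real.exp (-y) := by
  have h : (fun y : ℝ => Real.exp (-y)) = fun y => Real.exp ((-1) * y) := by
    funext y; ring_nf
  rw [h, iteratedDeriv_exp_const_mul]
  ring_nf

/-- **`φ⁽ⁿ⁾(s) = ∫₀¹ vⁿ (−1)ⁿ e^{−sv} dv`.** [folklore] -/
theorem iteratedDeriv_burgersPhi (n : ℕ) (s : ℝ) :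
    iteratedDeriv n burgersPhi s =
      ∫ v in (0 : ℝ)..1, v ^ n * ((-1) ^ n * Real.exp (-(s * v))) := by
  have hfun : burgersPhi = fun s => ∫ v in (0 : ℝ)..1, v ^ 0 * (fun y => Real.exp (-y)) (s * v) := by
    funext s
    rw [burgersPhi_eq_integral]
    simp
  rw [hfun, Calculus.iteratedDeriv_integral_pow_mul_comp_mul contDiff_exp_neg' n 0]
  simp only [zero_add, iteratedDeriv_exp_neg']

/-- **`|φ⁽ⁿ⁾(s)| ≤ 1` for `s ≥ 0`.** [folklore] -/
theorem abs_iteratedDeriv_burgersPhi_le (n : ℕ) {s : ℝ} (hs : 0 ≤ s) :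
    |iteratedDeriv n burgersPhi s| ≤ 1 := by
  rw [iteratedDeriv_burgersPhi]
  refine Calculus.norm_integral_pow_mul_comp_mul_le (g := fun y => (-1) ^ n * Real.exp (-y)) n
    fun v hv => ?_
  show |(-1 : ℝ) ^ n * Real.exp (-(s * v))| ≤ 1
  rw [abs_mul, abs_pow, abs_neg, abs_one, one_pow, one_mul, Real.abs_exp, Real.exp_le_one_iff,
    neg_nonpos]
  exact mul_nonneg hs hv.1

/-- `e^{−s} ≤ φ(s)` for `s ≥ 0` (`e^s − 1 ≥ s`). [folklore] -/
theorem exp_neg_le_burgersPhi {s : ℝ} (hs : 0 ≤ s) : Real.exp (-s) ≤ burgersPhi s := by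
  rcases hs.eq_or_lt with rfl | hs'
  · simp
  · rw [burgersPhi_of_ne_zero hs'.ne', le_div_iff₀ hs']
    have h1 : s + 1 ≤ Real.exp s := Real.add_one_le_exp s
    have h2 : Real.exp (-s) * Real.exp s = 1 := by rw [← Real.exp_add, neg_add_cancel, Real.exp_zero]
    have h3 : 0 < Real.exp (-s) := Real.exp_pos _
    nlinarith

/-- **`1 ≤ (1 + s) φ(s)` for `s ≥ 0`**, i.e. `1/φ(s) ≤ 1 + s`. [folklore] -/
theorem one_le_one_add_mul_burgersPhi {s : ℝ} (hs : 0 ≤ s) : 1 ≤ (1 + s) * burgersPhi s := by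
  have h1 := mul_burgersPhi s
  have h2 := exp_neg_le_burgersPhi hs
  nlinarith

/-- `1/φ` is smooth. [folklore] -/
theorem contDiff_inv_burgersPhi {n : WithTop ℕ∞} : ContDiff ℝ n fun s => (burgersPhi s)⁻¹ :=
  contDiff_burgersPhi.inv fun s => (burgersPhi_pos s).ne'

/-- `0 < 1/φ`. [folklore] -/
theorem inv_burgersPhi_pos (s : ℝ) : 0 < (burgersPhi s)⁻¹ := inv_pos.2 (burgersPhi_pos s)

/-! ### Polynomial bounds for the derivatives of `1/φ` on `[0, ∞)` -/

/-- The Leibniz identity for `φ · (1/φ) = 1` at order `n + 1`: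
`φ(s) u⁽ⁿ⁺¹⁾(s) = −∑_{i<n+1} C(n+1,i+1) φ⁽ⁱ⁺¹⁾(s) u⁽ⁿ⁻ⁱ⁾(s)`. [folklore] -/
theorem burgersPhi_mul_iteratedDeriv_inv_succ (n : ℕ) (s : ℝ) :
    burgersPhi s * iteratedDeriv (n + 1) (fun s => (burgersPhi s)⁻¹) s =
      -∑ i ∈ range (n + 1), ((n + 1).choose (i + 1) : ℝ) *
        iteratedDeriv (i + 1) burgersPhi s * iteratedDeriv (n + 1 - (i + 1)) (fun s => (burgersPhi s)⁻¹) s := by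
  have hL := iteratedDeriv_mul (n := n + 1) (x := s) (f := burgersPhi)
    (g := fun s => (burgersPhi s)⁻¹) contDiff_burgersPhi.contDiffAt contDiff_inv_burgersPhi.contDiffAt
  have hprod : (burgersPhi * fun s => (burgersPhi s)⁻¹) = fun _ => (1 : ℝ) := by
    funext x
    exact mul_inv_cancel₀ (burgersPhi_pos x).ne'
  rw [hprod, iteratedDeriv_const, if_neg (Nat.succ_ne_zero n), Finset.sum_range_succ'] at hL
  simp only [Nat.choose_zero_right, Nat.cast_one, one_mul, iteratedDeriv_zero, Nat.sub_zero] at hL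
  linarith

/-- **Polynomial bounds for `(1/φ)⁽ʲ⁾` on `[0, ∞)`**: for every `n` there is `K ≥ 0` with
`|u⁽ʲ⁾(s)| ≤ K (1 + s)^{j+1}` for all `j ≤ n`, `s ≥ 0` (`u = 1/φ`). [folklore] -/
theorem exists_abs_iteratedDeriv_inv_burgersPhi_le (n : ℕ) :
    ∃ K : ℝ, 0 ≤ K ∧ ∀ j ≤ n, ∀ s : ℝ, 0 ≤ s →
      |iteratedDeriv j (fun s => (burgersPhi s)⁻¹) s| ≤ K * (1 + s) ^ (j + 1) := by
  induction n with
  | zero =>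
    refine ⟨1, zero_le_one, fun j hj s hs => ?_⟩
    obtain rfl : j = 0 := Nat.le_zero.1 hj
    rw [iteratedDeriv_zero, abs_of_pos (inv_burgersPhi_pos s), zero_add, pow_one, one_mul]
    exact (inv_le_iff_one_le_mul₀ (burgersPhi_pos s)).2 (one_le_one_add_mul_burgersPhi hs)
  | succ n ih =>
    obtain ⟨K, hK0, hK⟩ := ih
    refine ⟨2 ^ (n + 1) * K + K, by positivity, fun j hj s hs => ?_⟩
    have h1s : 1 ≤ 1 + s := by linarith
    rcases Nat.lt_or_eq_of_le hj with hlt | rfl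
    · calc |iteratedDeriv j (fun s => (burgersPhi s)⁻¹) s| ≤ K * (1 + s) ^ (j + 1) :=
            hK j (Nat.lt_succ_iff.1 hlt) s hs
        _ ≤ (2 ^ (n + 1) * K + K) * (1 + s) ^ (j + 1) := by
            gcongr
            have : 0 ≤ 2 ^ (n + 1) * K := by positivity
            linarith
    · -- the top order `n + 1`
      have hsum : |∑ i ∈ range (n + 1), ((n + 1).choose (i + 1) : ℝ) *
          iteratedDeriv (i + 1) burgersPhi s *
          iteratedDeriv (n + 1 - (i + 1)) (fun s => (burgersPhi s)⁻¹) s| ≤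
          2 ^ (n + 1) * (K * (1 + s) ^ (n + 1)) := by
        refine (Finset.abs_sum_le_sum_abs _ _).trans ?_
        have hterm : ∀ i ∈ range (n + 1), |((n + 1).choose (i + 1) : ℝ) *
            iteratedDeriv (i + 1) burgersPhi s *
            iteratedDeriv (n + 1 - (i + 1)) (fun s => (burgersPhi s)⁻¹) s| ≤
            ((n + 1).choose (i + 1) : ℝ) * (K * (1 + s) ^ (n + 1)) := by
          intro i hi
          have hin : i < n + 1 := mem_range.1 hi
          have hsub : n + 1 - (i + 1) = n - i := by omega
          rw [hsub, abs_mul, abs_mul, Nat.abs_cast]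
          have hφ := abs_iteratedDeriv_burgersPhi_le (i + 1) hs
          have hu := hK (n - i) (Nat.sub_le n i) s hs
          calc ((n + 1).choose (i + 1) : ℝ) * |iteratedDeriv (i + 1) burgersPhi s| *
                |iteratedDeriv (n - i) (fun s => (burgersPhi s)⁻¹) s|
              ≤ ((n + 1).choose (i + 1) : ℝ) * 1 * (K * (1 + s) ^ (n - i + 1)) := by
                gcongr
            _ ≤ ((n + 1).choose (i + 1) : ℝ) * 1 * (K * (1 + s) ^ (n + 1)) := by
                apply mul_le_mul_of_nonneg_left _ (by positivity)
                apply mul_le_mul_of_nonneg_left _ hK0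
                exact pow_le_pow_right₀ h1s (by omega)
            _ = ((n + 1).choose (i + 1) : ℝ) * (K * (1 + s) ^ (n + 1)) := by ring
        refine (Finset.sum_le_sum hterm).trans ?_
        rw [← Finset.sum_mul]
        gcongr
        -- `∑_{i<n+1} C(n+1,i+1) ≤ 2^{n+1}`
        have h2 := Nat.sum_range_choose (n + 1)
        rw [Finset.sum_range_succ'] at h2
        have h3 : (∑ i ∈ range (n + 1), ((n + 1).choose (i + 1) : ℝ)) =
            ((∑ i ∈ range (n + 1), (n + 1).choose (i + 1) : ℕ) : ℝ) := by push_cast; rfl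
        rw [h3]
        exact_mod_cast (Nat.le_add_right _ _).trans_eq h2
      have hkey := burgersPhi_mul_iteratedDeriv_inv_succ n s
      have hp := burgersPhi_pos s
      have hinv : (burgersPhi s)⁻¹ ≤ 1 + s :=
        (inv_le_iff_one_le_mul₀ hp).2 (one_le_one_add_mul_burgersPhi hs)
      have heq : iteratedDeriv (n + 1) (fun s => (burgersPhi s)⁻¹) s =
          (burgersPhi s)⁻¹ * (burgersPhi s * iteratedDeriv (n + 1) (fun s => (burgersPhi s)⁻¹) s) := by
        rw [← mul_assoc, inv_mul_cancel₀ hp.ne', one_mul]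
      rw [heq, hkey, abs_mul, abs_neg, abs_of_pos (inv_burgersPhi_pos s)]
      calc (burgersPhi s)⁻¹ * |∑ i ∈ range (n + 1), ((n + 1).choose (i + 1) : ℝ) *
            iteratedDeriv (i + 1) burgersPhi s *
            iteratedDeriv (n + 1 - (i + 1)) (fun s => (burgersPhi s)⁻¹) s|
          ≤ (1 + s) * (2 ^ (n + 1) * (K * (1 + s) ^ (n + 1))) := by gcongr
        _ = 2 ^ (n + 1) * K * (1 + s) ^ (n + 1 + 1) := by ring
        _ ≤ (2 ^ (n + 1) * K + K) * (1 + s) ^ (n + 1 + 1) := by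
            gcongr
            linarith

/-! ### Reflection `s ↦ −s` and temperate growth on `ℝ` -/

/-- **`φ(−s) = eˢ φ(s)`.** [folklore] -/
theorem burgersPhi_neg (s : ℝ) : burgersPhi (-s) = Real.exp s * burgersPhi s := by
  by_cases hs : s = 0
  · subst hs; simp
  · have h1 := mul_burgersPhi s
    have h2 := mul_burgersPhi (-s)
    rw [neg_neg] at h2
    have h3 : Real.exp (-s) * Real.exp s = 1 := by rw [← Real.exp_add, neg_add_cancel, Real.exp_zero]
    apply mul_left_cancel₀ hs
    have h4 : s * (Real.exp s * burgersPhi s) = Real.exp s * (s * burgersPhi s) := by ring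
    rw [h4, h1]
    nlinarith [Real.exp_pos s]

/-- **`u(s) = s + u(−s)`** for `u = 1/φ` (i.e. `s/(1 − e^{−s}) = s + s/(eˢ − 1)`). [folklore] -/
theorem inv_burgersPhi_eq_add (s : ℝ) : (burgersPhi s)⁻¹ = s + (burgersPhi (-s))⁻¹ := by
  have hp := burgersPhi_pos s
  have he := Real.exp_pos s
  have h1 := mul_burgersPhi s
  have h3 : Real.exp (-s) * Real.exp s = 1 := by rw [← Real.exp_add, neg_add_cancel, Real.exp_zero]
  rw [burgersPhi_neg, mul_inv]
  field_simp
  nlinarith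

/-- **`1/φ` has temperate growth on `ℝ`** (`φ(s) = (1 − e^{−s})/s`). [folklore] -/
theorem hasTemperateGrowth_inv_burgersPhi :
    Function.HasTemperateGrowth fun s => (burgersPhi s)⁻¹ := by
  refine ⟨contDiff_inv_burgersPhi, fun n => ?_⟩
  obtain ⟨K, hK0, hK⟩ := exists_abs_iteratedDeriv_inv_burgersPhi_le n
  refine ⟨n + 1, K + 2, fun s => ?_⟩
  rw [norm_iteratedFDeriv_eq_norm_iteratedDeriv, Real.norm_eq_abs, Real.norm_eq_abs]
  have h1 : 1 ≤ 1 + |s| := by linarith [abs_nonneg s]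
  have hpow : 1 + |s| ≤ (1 + |s|) ^ (n + 1) := le_self_pow₀ h1 (Nat.succ_ne_zero n)
  rcases le_or_gt 0 s with hs | hs
  · calc |iteratedDeriv n (fun s => (burgersPhi s)⁻¹) s| ≤ K * (1 + s) ^ (n + 1) := hK n le_rfl s hs
      _ = K * (1 + |s|) ^ (n + 1) := by rw [abs_of_nonneg hs]
      _ ≤ (K + 2) * (1 + |s|) ^ (n + 1) := by gcongr; linarith
  · have hfun : (fun s => (burgersPhi s)⁻¹) = fun s => s + (burgersPhi (-s))⁻¹ :=
      funext inv_burgersPhi_eq_add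
    have hadd : iteratedDeriv n (fun s => s + (burgersPhi (-s))⁻¹) s =
        iteratedDeriv n (fun s : ℝ => s) s + iteratedDeriv n (fun s => (burgersPhi (-s))⁻¹) s :=
      iteratedDeriv_fun_add contDiff_id.contDiffAt
        ((contDiff_inv_burgersPhi (n := n)).comp contDiff_neg).contDiffAt
    have hneg := iteratedDeriv_comp_neg n (fun s => (burgersPhi s)⁻¹) s
    have hid : |iteratedDeriv n (fun s : ℝ => s) s| ≤ 1 + |s| := by
      rw [iteratedDeriv_fun_id]
      split_ifs
      · linarith [abs_nonneg s]
      · rw [abs_one]; linarith [abs_nonneg s]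
      · rw [abs_zero]; positivity
    have hK' := hK n le_rfl (-s) (by linarith)
    rw [show (1 + -s) = 1 + |s| by rw [abs_of_neg hs]] at hK'
    conv_lhs => rw [hfun]
    rw [hadd, hneg]
    calc |iteratedDeriv n (fun s : ℝ => s) s +
          (-1 : ℝ) ^ n • iteratedDeriv n (fun s => (burgersPhi s)⁻¹) (-s)|
        ≤ |iteratedDeriv n (fun s : ℝ => s) s| +
          |(-1 : ℝ) ^ n • iteratedDeriv n (fun s => (burgersPhi s)⁻¹) (-s)| := abs_add_le _ _
      _ ≤ (1 + |s|) + K * (1 + |s|) ^ (n + 1) := by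
          refine add_le_add hid ?_
          rw [smul_eq_mul, abs_mul, abs_pow, abs_neg, abs_one, one_pow, one_mul]
          exact hK'
      _ ≤ (K + 2) * (1 + |s|) ^ (n + 1) := by nlinarith

end Literature.Analysis.FluidPDE
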